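import Mathlib
import Summits.PneNP.PneNP.Theorems.SignRepCertificate
import Summits.PneNP.PneNP.Theorems.LtfLocalAvoidCore

/-!
# F-N2a for general LTF tables (pnp-ideate-p3 ROUND-17 Prop. B with the referee's constant slot):
# greedy potential signing against weighted star loads AND the bias

For a `k`-local map whose output tables carry degree-≤1 integer sign-representations
(`SignRepCertificate.Cert` with vanishing quadratic part: `g_j(U) = c₀(j) + Σ_i c₁(j,i) U_i`,
`pm(P_j u)·g_j(u) ≥ τ`), one pass over the outputs choosing each sign AGAINST the current correlation
`c₀(j)·B + Σ_i c₁(j,i)·D_{vars j i}` (bias slot included, as the referee's NIT-2 requires) keeps the potential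
`B² + Σ_v D_v²` below `W²·m` (`W` = a bound on the per-output ℓ₁ weight), hence
`|B| + Σ_v |D_v| ≤ W·√((n+1)·m) < τ·m` as soon as `(n+1)·W² < τ²·m`, and the landed conclusion lemma
`SignRepCertificate.not_mem_range_of_certificate` puts the greedy bit-string outside the range.
Linear stretch `m > (n+1)·W²/τ²` for every LTF-local map (weights and margin from a finite per-`k` table).
FRONTIER; nothing here bears on P vs NP.
-/

namespace Summit.PneNP.PneNP.Theorems.LtfGreedySigning

open Literature.Computability.Complexity Finset SignRepCertificate LtfLocalAvoidCore

variable {k n m : ℕ}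

/-- Contribution vector of output `j` on the slots `none` (= bias) and `some v` (= position `v`). -/
def wvec (I : LocalMap k n m) (c : Cert I) (j : Fin m) : Option (Fin n) → ℤ
  | none => c.c0 j
  | some v => ∑ i : Fin k, if I.vars j i = v then c.c1 j i else 0

/-- ℓ₁ mass of the contribution vector is at most the ℓ₁ weight of the certificate row. -/
lemma sum_abs_wvec_le (I : LocalMap k n m) (c : Cert I) (j : Fin m) :
    ∑ o : Option (Fin n), |wvec I c j o| ≤ |c.c0 j| + ∑ i : Fin k, |c.c1 j i| := by
  rw [Fintype.sum_option]
  simp only [wvec]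
  gcongr
  calc ∑ v : Fin n, |∑ i : Fin k, if I.vars j i = v then c.c1 j i else 0|
      ≤ ∑ v : Fin n, ∑ i : Fin k, |if I.vars j i = v then c.c1 j i else 0| :=
        Finset.sum_le_sum fun v _ => Finset.abs_sum_le_sum_abs _ _
    _ = ∑ i : Fin k, ∑ v : Fin n, |if I.vars j i = v then c.c1 j i else 0| := Finset.sum_comm
    _ = ∑ i : Fin k, |c.c1 j i| := by
        refine Finset.sum_congr rfl fun i _ => ?_
        have : ∀ v, |if I.vars j i = v then c.c1 j i else 0| = if I.vars j i = v then |c.c1 j i| else 0 :=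
          fun v => by split_ifs <;> simp
        simp_rw [this]
        rw [Finset.sum_ite_eq]; simp

/-- Sum of squares is at most the square of the ℓ₁ mass. -/
lemma sum_sq_le_sq_sum_abs {ι : Type*} (s : Finset ι) (f : ι → ℤ) :
    ∑ o ∈ s, (f o) ^ 2 ≤ (∑ o ∈ s, |f o|) ^ 2 := by
  have hS : 0 ≤ ∑ o ∈ s, |f o| := Finset.sum_nonneg fun o _ => abs_nonneg _
  calc ∑ o ∈ s, (f o) ^ 2 = ∑ o ∈ s, |f o| * |f o| := by
        refine Finset.sum_congr rfl fun o _ => ?_; rw [← sq, sq_abs]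
    _ ≤ ∑ o ∈ s, |f o| * ∑ o' ∈ s, |f o'| :=
        Finset.sum_le_sum fun o ho =>
          mul_le_mul_of_nonneg_left (Finset.single_le_sum (fun o' _ => abs_nonneg (f o')) ho) (abs_nonneg _)
    _ = (∑ o ∈ s, |f o|) ^ 2 := by rw [← Finset.sum_mul, sq]

/-- Per-step potential increment bound: `Σ_o wvec² ≤ W²`. -/
lemma sum_wvec_sq_le (I : LocalMap k n m) (c : Cert I) (W : ℤ)
    (hW : ∀ j, |c.c0 j| + ∑ i : Fin k, |c.c1 j i| ≤ W) (j : Fin m) :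
    ∑ o : Option (Fin n), (wvec I c j o) ^ 2 ≤ W ^ 2 := by
  have h1 := sum_sq_le_sq_sum_abs (Finset.univ : Finset (Option (Fin n))) (wvec I c j)
  have h2 := sum_abs_wvec_le I c j
  have h0 : 0 ≤ ∑ o : Option (Fin n), |wvec I c j o| := Finset.sum_nonneg fun o _ => abs_nonneg _
  have h3 : (∑ o : Option (Fin n), |wvec I c j o|) ^ 2 ≤ W ^ 2 := by
    have : ∑ o : Option (Fin n), |wvec I c j o| ≤ W := h2.trans (hW j)
    nlinarith
  exact h1.trans h3

/-- Slot loads after greedily signing the first `t` outputs. -/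
def greedyAuxW (I : LocalMap k n m) (c : Cert I) : ℕ → (Option (Fin n) → ℤ)
  | 0 => fun _ => 0
  | t + 1 =>
      if h : t < m then
        fun o => greedyAuxW I c t o +
          pickSign (∑ o' : Option (Fin n), greedyAuxW I c t o' * wvec I c ⟨t, h⟩ o') * wvec I c ⟨t, h⟩ o
      else greedyAuxW I c t

/-- The greedy sign of output `j`. -/
def greedySignW (I : LocalMap k n m) (c : Cert I) (j : Fin m) : ℤ :=
  pickSign (∑ o' : Option (Fin n), greedyAuxW I c j.val o' * wvec I c j o')

/-- Greedy signs are `±1`. -/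
lemma greedySignW_cases (I : LocalMap k n m) (c : Cert I) (j : Fin m) :
    greedySignW I c j = 1 ∨ greedySignW I c j = -1 := pickSign_cases _

/-- One greedy step. -/
lemma greedyAuxW_succ (I : LocalMap k n m) (c : Cert I) (t : ℕ) (h : t < m) (o : Option (Fin n)) :
    greedyAuxW I c (t + 1) o = greedyAuxW I c t o + greedySignW I c ⟨t, h⟩ * wvec I c ⟨t, h⟩ o := by
  simp [greedyAuxW, h, greedySignW]

/-- Potential bound: `Σ_o (load after t steps)² ≤ W² · t`. -/
lemma potentialW_le (I : LocalMap k n m) (c : Cert I) (W : ℤ)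
    (hW : ∀ j, |c.c0 j| + ∑ i : Fin k, |c.c1 j i| ≤ W) : ∀ t, t ≤ m →
    ∑ o : Option (Fin n), (greedyAuxW I c t o) ^ 2 ≤ W ^ 2 * t := by
  intro t
  induction t with
  | zero => intro _; simp [greedyAuxW]
  | succ t ih =>
      intro ht
      have h : t < m := Nat.lt_of_succ_le ht
      have ih' := ih h.le
      set a := greedyAuxW I c t with ha
      set w := wvec I c ⟨t, h⟩ with hw
      set s := greedySignW I c ⟨t, h⟩ with hs
      have hstep : ∀ o, greedyAuxW I c (t + 1) o = a o + s * w o := fun o => greedyAuxW_succ I c t h o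
      simp_rw [hstep]
      have hexp : ∑ o : Option (Fin n), (a o + s * w o) ^ 2
          = ∑ o : Option (Fin n), (a o) ^ 2 + 2 * (s * ∑ o : Option (Fin n), a o * w o)
            + s ^ 2 * ∑ o : Option (Fin n), (w o) ^ 2 := by
        rw [Finset.mul_sum, Finset.mul_sum, Finset.mul_sum, ← Finset.sum_add_distrib, ← Finset.sum_add_distrib]
        refine Finset.sum_congr rfl fun o _ => by ring
      have hcorr : s * ∑ o : Option (Fin n), a o * w o ≤ 0 := by
        rw [hs, greedySignW]; exact pickSign_mul_nonpos _
      have hs2 : s ^ 2 = 1 := by rw [hs, greedySignW]; exact pickSign_sq _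
      have hw2 : ∑ o : Option (Fin n), (w o) ^ 2 ≤ W ^ 2 := sum_wvec_sq_le I c W hW ⟨t, h⟩
      rw [hexp, hs2, one_mul]
      push_cast
      nlinarith

/-- The greedy loads are the signed contribution sums of the greedy sign vector. -/
lemma greedyAuxW_eq_sum (I : LocalMap k n m) (c : Cert I) : ∀ t, t ≤ m → ∀ o,
    greedyAuxW I c t o = ∑ j : Fin m, if j.val < t then greedySignW I c j * wvec I c j o else 0 := by
  intro t
  induction t with
  | zero => intro _ o; simp [greedyAuxW]
  | succ t ih =>
      intro ht o
      have h : t < m := Nat.lt_of_succ_le ht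
      rw [greedyAuxW_succ I c t h o, ih h.le o]
      have hsplit : ∀ j : Fin m, (if j.val < t + 1 then greedySignW I c j * wvec I c j o else 0)
          = (if j.val < t then greedySignW I c j * wvec I c j o else 0)
            + (if j = ⟨t, h⟩ then greedySignW I c j * wvec I c j o else 0) := by
        intro j
        by_cases hj : j.val < t
        · have hne : j ≠ ⟨t, h⟩ := fun e => by simp [e] at hj
          simp [hj, hne, Nat.lt_succ_of_lt hj]
        · by_cases hj' : j = ⟨t, h⟩
          · subst hj'; simp
          · have : ¬ j.val < t + 1 := fun e => by
              rcases Nat.lt_succ_iff_lt_or_eq.mp e with e | e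
              · exact hj e
              · exact hj' (Fin.ext e)
            simp [hj, hj', this]
      simp_rw [hsplit, Finset.sum_add_distrib, Finset.sum_ite_eq']
      simp

/-- Final bias slot = `bias`. -/
lemma bias_greedy (I : LocalMap k n m) (c : Cert I) :
    bias I c (greedySignW I c) = greedyAuxW I c m none := by
  rw [greedyAuxW_eq_sum I c m le_rfl none]
  unfold bias
  refine Finset.sum_congr rfl fun j _ => ?_
  simp [j.isLt, wvec]

/-- Final position slots = `load`. -/
lemma load_greedy (I : LocalMap k n m) (c : Cert I) (v : Fin n) :
    load I c (greedySignW I c) v = greedyAuxW I c m (some v) := by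
  rw [greedyAuxW_eq_sum I c m le_rfl (some v)]
  unfold load
  refine Finset.sum_congr rfl fun j _ => ?_
  simp only [j.isLt, if_true, wvec]
  rw [Finset.mul_sum]
  refine Finset.sum_congr rfl fun i _ => ?_
  split_ifs <;> simp

/-- **Greedy bound with bias**: `(|B| + Σ_v |D_v|)² ≤ (n+1) · W² · m`. -/
theorem greedyW_sq_le (I : LocalMap k n m) (c : Cert I) (W : ℤ)
    (hW : ∀ j, |c.c0 j| + ∑ i : Fin k, |c.c1 j i| ≤ W) :
    (|bias I c (greedySignW I c)| + ∑ v : Fin n, |load I c (greedySignW I c) v|) ^ 2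
      ≤ ((n : ℤ) + 1) * W ^ 2 * m := by
  have hsum : |bias I c (greedySignW I c)| + ∑ v : Fin n, |load I c (greedySignW I c) v|
      = ∑ o : Option (Fin n), |greedyAuxW I c m o| := by
    rw [Fintype.sum_option, bias_greedy]
    simp_rw [load_greedy]
  rw [hsum]
  have hcs : (∑ o : Option (Fin n), |greedyAuxW I c m o|) ^ 2
      ≤ (∑ _o : Option (Fin n), (1:ℤ) ^ 2) * ∑ o : Option (Fin n), |greedyAuxW I c m o| ^ 2 := by
    have := Finset.sum_mul_sq_le_sq_mul_sq (Finset.univ : Finset (Option (Fin n)))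
      (fun _ => (1:ℤ)) (fun o => |greedyAuxW I c m o|)
    simpa using this
  have hcard : (∑ _o : Option (Fin n), (1:ℤ) ^ 2) = (n : ℤ) + 1 := by simp
  have hpot : ∑ o : Option (Fin n), |greedyAuxW I c m o| ^ 2 ≤ W ^ 2 * m := by
    simp_rw [sq_abs]
    exact potentialW_le I c W hW m le_rfl
  rw [hcard] at hcs
  calc _ ≤ ((n : ℤ) + 1) * ∑ o : Option (Fin n), |greedyAuxW I c m o| ^ 2 := hcs
    _ ≤ ((n : ℤ) + 1) * (W ^ 2 * m) := mul_le_mul_of_nonneg_left hpot (by positivity)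
    _ = ((n : ℤ) + 1) * W ^ 2 * m := by ring

/-- The explicit answer: the greedy bit-string. -/
def greedyBitsW (I : LocalMap k n m) (c : Cert I) : Fin m → Bool :=
  fun j => decide (greedySignW I c j = -1)

/-- **F-N2a, general LTF tables, combinatorial form**: for degree-≤1 certificates (no quadratic part) with
per-output ℓ₁ weight ≤ `W` and margin `τ > 0`, at stretch `(n+1)·W² < τ²·m` the greedy bit-string (bias slot
included) is outside the range.  (Polynomial time of the one pass = the separate FP wrapper.) -/
theorem greedyBitsW_not_mem_range (I : LocalMap k n m) (c : Cert I)
    (hc2 : ∀ j i i', c.c2 j i i' = 0) (W : ℤ) (hW : ∀ j, |c.c0 j| + ∑ i : Fin k, |c.c1 j i| ≤ W)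
    (hτ : 0 < c.τ) (hm : ((n : ℤ) + 1) * W ^ 2 < c.τ ^ 2 * m) :
    greedyBitsW I c ∉ I.range := by
  have hY := greedySignW_cases I c
  refine not_mem_range_of_certificate I c (greedySignW I c) hY 0 ?_ ?_
  · intro X _
    simp [pairForm, hc2]
  · have hsq := greedyW_sq_le I c W hW
    set B := bias I c (greedySignW I c)
    set D := ∑ v : Fin n, |load I c (greedySignW I c) v|
    have hD : 0 ≤ D := Finset.sum_nonneg fun v _ => abs_nonneg _
    have hB : B ≤ |B| := le_abs_self B
    have hmpos : (0 : ℤ) < m := by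
      by_contra h0
      push Not at h0
      have : c.τ ^ 2 * (m : ℤ) ≤ 0 := mul_nonpos_of_nonneg_of_nonpos (sq_nonneg _) h0
      nlinarith [sq_nonneg W]
    -- (|B| + D)² ≤ (n+1) W² m < τ² m², hence |B| + D < τ m
    have hlt : (|B| + D) ^ 2 < (c.τ * m) ^ 2 := by
      calc (|B| + D) ^ 2 ≤ ((n : ℤ) + 1) * W ^ 2 * m := hsq
        _ < c.τ ^ 2 * m * m := by nlinarith
        _ = (c.τ * m) ^ 2 := by ring
    have hnn : 0 ≤ |B| + D := add_nonneg (abs_nonneg _) hD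
    have hτm : 0 ≤ c.τ * m := mul_nonneg hτ.le (by exact_mod_cast (Nat.zero_le m))
    have : |B| + D < c.τ * m := by
      by_contra hge; push Not at hge
      have := mul_self_le_mul_self hτm hge
      nlinarith
    linarith

end Summit.PneNP.PneNP.Theorems.LtfGreedySigning
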